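import Literature.MathematicalPhysics.QuantumLattice.SchwingerWightmanSymmetry
import Mathlib.Data.Fin.Tuple.Sort
import Mathlib.Order.PiLex
import HarnessLib

/-!
# Lexicographic sorting of Euclidean configurations and linear tube certificates

Topic `Literature/MathematicalPhysics/QuantumLattice` (trunk T-AQFT). Geometric input for the
symmetry of the Schwinger functions of a Wightman QFT in space dimension `d ≥ 2`
(`IsWickRotationOf.schwinger_symmetric`, Osterwalder–Schrader I (1973) §5 p. 97 / Glimm–Jaffe
(1987) Cor. 19.5.6: "non-coincident Euclidean points lie in the permuted extended tube; the
continued Wightman function is symmetric there"), organised so that no statement about the global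
geometry of the permuted extended tube is needed:

* `lexKey`, `eSort x` — the permutation sorting the points `x_k ∈ ℝ^{d+1}` of a Euclidean
  configuration **lexicographically, Euclidean time first** (`Tuple.sort` on `Lex` keys). It is
  relabelling invariant (`comp_eSort_comp_perm`: `(x ∘ τ) ∘ eSort (x ∘ τ) = x ∘ eSort x`) and the
  identity on configurations with strictly increasing times (`eSort_eq_one_of_strictMono`).
* **Linear certificates for the extended tube.** If along the ordering `σ` the heights
  `⟪u, x_{σ(k)}⟫` are strictly increasing for some `u ≠ 0`, then the Euclidean point
  `(i x⁰_{σ(k)}, x⃗_{σ(k)})_k` lies in the extended relative tube: the Euclidean rotation with first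
  row `u/‖u‖` complexifies to an element of `L₊(ℂ)` (`wickEquiv`) and rotates the configuration to
  one with strictly increasing times, i.e. into `𝒯ʳₙ` (OS I §5 p. 97; Glimm–Jaffe Cor. 19.5.6:
  "a small Euclidean rotation produces all unequal times") —
  `euclideanPoint_perm_mem_relExtendedTube_of_strictMono`. The set of configurations so certified
  by a fixed `(σ, u)` is **convex** (`convex_certSet`).
* **Certificates exist for the lexicographic order**: the vectors `u_ε = (1, ε, …, ε^d)` have
  positive inner product with any finite set of lexicographically positive vectors for small
  `ε > 0` (`eventually_sum_pow_mul_pos`), hence certify `eSort x` for every injective `x`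
  (`eventually_strictMono_inner_uPow_eSort`), and — by continuity — certify the *fixed* ordering
  `eSort x` for all configurations near `x` (`eventually_strictMono_inner_uPow_nhds`).

## References

* K. Osterwalder, R. Schrader, Comm. Math. Phys. 31 (1973), §5 p. 97. [OsterwalderSchraderCMP1973]
* J. Glimm, A. Jaffe, *Quantum Physics* (1987), Cor. 19.5.6. [GlimmJaffeQP1987]

## Mathlib / tree

`Tuple.sort`, `Tuple.monotone_sort`, `Tuple.unique_monotone`, `Tuple.sort_eq_refl_iff_monotone`,
`Pi.Lex` (`toLex`), `Fin.strictMono_iff_lt_succ`, `Filter.eventually_all`; tree: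
`exists_specialOrthogonal_row_zero`, `wickEquiv`, `wickEquiv_mem_properComplexLorentzGroup`,
`wickMatrix_mulVec_euclideanPoint`, `rotateConfig`, `euclideanPoint_mem_relForwardTube`
(`SchwingerWightmanSymmetry`).
-/

noncomputable section

open Filter Set
open _root_.Topology
open scoped RealInnerProductSpace Matrix

namespace Literature.MathematicalPhysics.QuantumLattice

variable {d n : ℕ}

/-! ### Lexicographic keys and the sorting permutation -/

/-- The lexicographic key of the `k`-th point: its coordinate vector, time coordinate first, in the
lexicographic order. [folklore] -/
def lexKey (x : Fin n → EuclideanSpace ℝ (Fin (d + 1))) (k : Fin n) : Lex (Fin (d + 1) → ℝ) :=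
  toLex fun μ => x k μ

/-- Unfolding the lexicographic comparison of two keys. [folklore] -/
theorem lexKey_lt_iff (x : Fin n → EuclideanSpace ℝ (Fin (d + 1))) (k l : Fin n) :
    lexKey x k < lexKey x l ↔ ∃ μ : Fin (d + 1), (∀ ν < μ, x k ν = x l ν) ∧ x k μ < x l μ :=
  Iff.rfl

/-- Distinct points have distinct keys. [folklore] -/
theorem lexKey_injective {x : Fin n → EuclideanSpace ℝ (Fin (d + 1))} (hx : Function.Injective x) :
    Function.Injective (lexKey x) := by
  intro k l h
  apply hx
  ext μ
  exact congr_fun (toLex.injective h : (fun μ => x k μ) = fun μ => x l μ) μ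

/-- Keys of a relabelled configuration. [folklore] -/
theorem lexKey_comp_perm (x : Fin n → EuclideanSpace ℝ (Fin (d + 1))) (τ : Equiv.Perm (Fin n)) :
    lexKey (x ∘ τ) = lexKey x ∘ τ := rfl

/-- **The lexicographic sorting permutation** of a Euclidean configuration (time first). [folklore] -/
def eSort (x : Fin n → EuclideanSpace ℝ (Fin (d + 1))) : Equiv.Perm (Fin n) :=
  Tuple.sort (lexKey x)

/-- The keys are monotone along `eSort`. [folklore] -/
theorem monotone_lexKey_eSort (x : Fin n → EuclideanSpace ℝ (Fin (d + 1))) :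
    Monotone (lexKey x ∘ eSort x) :=
  Tuple.monotone_sort _

/-- For an injective configuration the keys are strictly increasing along `eSort`. [folklore] -/
theorem strictMono_lexKey_eSort {x : Fin n → EuclideanSpace ℝ (Fin (d + 1))}
    (hx : Function.Injective x) : StrictMono (lexKey x ∘ eSort x) :=
  (monotone_lexKey_eSort x).strictMono_of_injective
    ((lexKey_injective hx).comp (eSort x).injective)

/-- **Relabelling invariance of the sorted configuration**: sorting `x ∘ τ` gives the same ordered
tuple of points as sorting `x`. [folklore] -/
theorem comp_eSort_comp_perm (x : Fin n → EuclideanSpace ℝ (Fin (d + 1))) (τ : Equiv.Perm (Fin n)) :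
    (x ∘ τ) ∘ eSort (x ∘ τ) = x ∘ eSort x := by
  have h1 : Monotone (lexKey x ∘ (τ * eSort (x ∘ τ))) := by
    have := monotone_lexKey_eSort (x ∘ τ)
    rwa [lexKey_comp_perm] at this
  have h2 := Tuple.unique_monotone h1 (monotone_lexKey_eSort x)
  funext k
  have hk := congr_fun h2 k
  simp only [Function.comp_apply, Equiv.Perm.coe_mul] at hk
  ext μ
  exact congr_fun (toLex.injective hk : (fun μ => x (τ (eSort (x ∘ τ) k)) μ) =
    fun μ => x (eSort x k) μ) μ

/-- The same, pointwise. [folklore] -/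
theorem perm_eSort_comp_perm_apply (x : Fin n → EuclideanSpace ℝ (Fin (d + 1)))
    (τ : Equiv.Perm (Fin n)) (k : Fin n) : x (τ (eSort (x ∘ τ) k)) = x (eSort x k) :=
  congr_fun (comp_eSort_comp_perm x τ) k

/-- **On configurations with strictly increasing times the sorting permutation is the identity.** [folklore] -/
theorem eSort_eq_one_of_strictMono {x : Fin n → EuclideanSpace ℝ (Fin (d + 1))}
    (h : StrictMono fun k => x k 0) : eSort x = 1 := by
  have hmono : Monotone (lexKey x) := by
    refine (StrictMono.monotone fun k l hkl => ?_)
    exact (lexKey_lt_iff x k l).2 ⟨0, fun ν hν => absurd hν (Fin.not_lt_zero ν), h hkl⟩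
  exact (Tuple.sort_eq_refl_iff_monotone.2 hmono : Tuple.sort (lexKey x) = Equiv.refl _)

/-! ### Lexicographically positive vectors and the certifying directions `u_ε` -/

/-- The successive differences of the sorted configuration are lexicographically positive: their
first non-vanishing coordinate is positive. [folklore] -/
theorem exists_coord_pos_of_lexKey_lt {x : Fin n → EuclideanSpace ℝ (Fin (d + 1))} {k l : Fin n}
    (h : lexKey x k < lexKey x l) :
    ∃ μ : Fin (d + 1), (∀ ν < μ, x l ν - x k ν = 0) ∧ 0 < x l μ - x k μ := by
  obtain ⟨μ, hμ, hlt⟩ := (lexKey_lt_iff x k l).1 h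
  exact ⟨μ, fun ν hν => sub_eq_zero.2 (hμ ν hν).symm, sub_pos.2 hlt⟩

variable (d) in
/-- The certifying direction `u_ε = (1, ε, ε², …, ε^d) ∈ ℝ^{d+1}`. [folklore] -/
def uPow (ε : ℝ) : EuclideanSpace ℝ (Fin (d + 1)) := WithLp.toLp 2 fun μ => ε ^ (μ : ℕ)

/-- Coordinates of `u_ε`. [folklore] -/
@[simp]
theorem uPow_apply (ε : ℝ) (μ : Fin (d + 1)) : uPow d ε μ = ε ^ (μ : ℕ) := rfl

/-- `u_ε ≠ 0` (its time component is `1`). [folklore] -/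
theorem uPow_ne_zero (ε : ℝ) : uPow d ε ≠ 0 := by
  intro h
  have := congr_arg (fun v : EuclideanSpace ℝ (Fin (d + 1)) => v 0) h
  simp at this

/-- `⟪u_ε, v⟫ = ∑_μ ε^μ v_μ`. [folklore] -/
theorem inner_uPow (ε : ℝ) (v : EuclideanSpace ℝ (Fin (d + 1))) :
    ⟪uPow d ε, v⟫ = ∑ μ : Fin (d + 1), ε ^ (μ : ℕ) * v μ := by
  rw [EuclideanSpace.inner_eq_star_dotProduct, star_trivial, dotProduct_comm]
  rfl

/-- **`u_ε` is positive on a lexicographically positive vector for all small `ε > 0`**: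
if `v_ν = 0` for `ν < μ` and `v_μ > 0`, then `∑ ε^ν v_ν ≥ ε^μ (v_μ − ε ∑|v_ν|) > 0` for
`0 < ε ≤ 1`, `ε ∑|v_ν| < v_μ`. [folklore] -/
theorem eventually_sum_pow_mul_pos {v : Fin (d + 1) → ℝ} {μ : Fin (d + 1)}
    (hzero : ∀ ν < μ, v ν = 0) (hpos : 0 < v μ) :
    ∀ᶠ ε in 𝓝[>] (0 : ℝ), 0 < ∑ ν : Fin (d + 1), ε ^ (ν : ℕ) * v ν := by
  set S : ℝ := ∑ ν, |v ν| with hS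
  have hS0 : 0 ≤ S := Finset.sum_nonneg fun ν _ => abs_nonneg _
  have hev1 : ∀ᶠ ε in 𝓝[>] (0 : ℝ), ε < 1 := by
    exact (nhdsWithin_le_nhds (Iio_mem_nhds zero_lt_one))
  have hev2 : ∀ᶠ ε in 𝓝[>] (0 : ℝ), ε * S < v μ := by
    have : Tendsto (fun ε : ℝ => ε * S) (𝓝[>] 0) (𝓝 (0 * S)) :=
      (tendsto_id.mul_const S).mono_left nhdsWithin_le_nhds
    rw [zero_mul] at this
    exact this.eventually (Iio_mem_nhds hpos)
  filter_upwards [self_mem_nhdsWithin, hev1, hev2] with ε hε0 hε1 hεS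
  have hε0' : 0 < ε := hε0
  -- lower bound for each term
  have hterm : ∀ ν, ν ≠ μ → -(ε ^ ((μ : ℕ) + 1) * |v ν|) ≤ ε ^ (ν : ℕ) * v ν := by
    intro ν hν
    rcases lt_or_gt_of_ne hν with hlt | hgt
    · rw [hzero ν hlt]; simp
    · have hpow : ε ^ (ν : ℕ) ≤ ε ^ ((μ : ℕ) + 1) :=
        pow_le_pow_of_le_one hε0'.le hε1.le (Nat.succ_le_of_lt (Fin.lt_def.1 hgt))
      have h1 : -(ε ^ (ν : ℕ) * |v ν|) ≤ ε ^ (ν : ℕ) * v ν := by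
        have := neg_abs_le (v ν)
        nlinarith [pow_pos hε0' (ν : ℕ)]
      have h2 : ε ^ (ν : ℕ) * |v ν| ≤ ε ^ ((μ : ℕ) + 1) * |v ν| :=
        mul_le_mul_of_nonneg_right hpow (abs_nonneg _)
      linarith
  have hsplit : ∑ ν : Fin (d + 1), ε ^ (ν : ℕ) * v ν =
      ε ^ (μ : ℕ) * v μ + ∑ ν ∈ Finset.univ.erase μ, ε ^ (ν : ℕ) * v ν := by
    rw [← Finset.add_sum_erase _ _ (Finset.mem_univ μ)]
  have hrest : -(ε ^ ((μ : ℕ) + 1) * S) ≤ ∑ ν ∈ Finset.univ.erase μ, ε ^ (ν : ℕ) * v ν := by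
    have h1 : ∑ ν ∈ Finset.univ.erase μ, -(ε ^ ((μ : ℕ) + 1) * |v ν|) ≤
        ∑ ν ∈ Finset.univ.erase μ, ε ^ (ν : ℕ) * v ν :=
      Finset.sum_le_sum fun ν hν => hterm ν (Finset.ne_of_mem_erase hν)
    refine le_trans ?_ h1
    rw [Finset.sum_neg_distrib, neg_le_neg_iff, ← Finset.mul_sum]
    gcongr
    exact Finset.sum_le_univ_sum_of_nonneg fun ν => abs_nonneg _
  rw [hsplit]
  have hkey : ε ^ ((μ : ℕ) + 1) * S < ε ^ (μ : ℕ) * v μ := by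
    rw [pow_succ, mul_assoc]
    exact mul_lt_mul_of_pos_left hεS (pow_pos hε0' _)
  linarith

/-- **`u_ε` separates finitely many lexicographically increasing pairs**: for an injective
configuration, along `eSort x` the heights `⟪u_ε, x_{eSort x k}⟫` are strictly increasing for all
small `ε > 0`. [folklore] -/
theorem eventually_strictMono_inner_uPow_eSort {x : Fin n → EuclideanSpace ℝ (Fin (d + 1))}
    (hx : Function.Injective x) :
    ∀ᶠ ε in 𝓝[>] (0 : ℝ), StrictMono fun k => ⟪uPow d ε, x (eSort x k)⟫ := by
  cases n with
  | zero => exact Eventually.of_forall fun ε k => k.elim0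
  | succ m =>
    have hsm := strictMono_lexKey_eSort hx
    -- for each successive pair, eventually positive increment
    have hpair : ∀ j : Fin m, ∀ᶠ ε in 𝓝[>] (0 : ℝ),
        ⟪uPow d ε, x (eSort x j.castSucc)⟫ < ⟪uPow d ε, x (eSort x j.succ)⟫ := by
      intro j
      have hlt : lexKey x (eSort x j.castSucc) < lexKey x (eSort x j.succ) :=
        hsm (Fin.castSucc_lt_succ (i := j))
      obtain ⟨μ, hzero, hpos⟩ := exists_coord_pos_of_lexKey_lt hlt
      have hev := eventually_sum_pow_mul_pos (v := fun ν => x (eSort x j.succ) ν - x (eSort x j.castSucc) ν)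
        hzero hpos
      filter_upwards [hev] with ε hε
      rw [← sub_pos, ← inner_sub_right, inner_uPow]
      simpa only [PiLp.sub_apply] using hε
    filter_upwards [(eventually_all).2 hpair] with ε hε
    exact Fin.strictMono_iff_lt_succ.2 hε

/-- **The certificate of the sorted order persists nearby**: if `⟪u, x_{σ(k)}⟫` is strictly
increasing in `k`, then so is `⟪u, x'_{σ(k)}⟫` for all `x'` near `x` (finitely many strict
inequalities). [folklore] -/
theorem eventually_strictMono_inner_nhds {x : Fin n → EuclideanSpace ℝ (Fin (d + 1))}
    {u : EuclideanSpace ℝ (Fin (d + 1))} {σ : Equiv.Perm (Fin n)}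
    (h : StrictMono fun k => ⟪u, x (σ k)⟫) :
    ∀ᶠ x' in 𝓝 x, StrictMono fun k => ⟪u, x' (σ k)⟫ := by
  cases n with
  | zero => exact Eventually.of_forall fun x' k => k.elim0
  | succ m =>
    have hpair : ∀ j : Fin m, ∀ᶠ x' in 𝓝 x, ⟪u, x' (σ j.castSucc)⟫ < ⟪u, x' (σ j.succ)⟫ := by
      intro j
      have hc : Continuous fun x' : Fin (m + 1) → EuclideanSpace ℝ (Fin (d + 1)) =>
          ⟪u, x' (σ j.succ)⟫ - ⟪u, x' (σ j.castSucc)⟫ := by fun_prop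
      have h0 : 0 < ⟪u, x (σ j.succ)⟫ - ⟪u, x (σ j.castSucc)⟫ :=
        sub_pos.2 (h (Fin.castSucc_lt_succ (i := j)))
      filter_upwards [(isOpen_lt continuous_const hc).mem_nhds h0] with x' hx'
      exact sub_pos.1 hx'
    filter_upwards [(eventually_all).2 hpair] with x' hx'
    exact Fin.strictMono_iff_lt_succ.2 hx'

/-! ### Linear certificates for the extended relative tube -/

variable (n) in
/-- The **certificate set** of an ordering `σ` and a direction `u`: Euclidean configurations whose
heights `⟪u, x_{σ(k)}⟫` strictly increase along `σ`. [folklore] -/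
def certSet (σ : Equiv.Perm (Fin n)) (u : EuclideanSpace ℝ (Fin (d + 1))) :
    Set (Fin n → EuclideanSpace ℝ (Fin (d + 1))) :=
  {x | StrictMono fun k => ⟪u, x (σ k)⟫}

/-- Membership in a certificate set. [folklore] -/
theorem mem_certSet_iff {σ : Equiv.Perm (Fin n)} {u : EuclideanSpace ℝ (Fin (d + 1))}
    {x : Fin n → EuclideanSpace ℝ (Fin (d + 1))} :
    x ∈ certSet n σ u ↔ StrictMono fun k => ⟪u, x (σ k)⟫ := Iff.rfl

/-- **Certificate sets are convex** (strict monotonicity of finitely many linear functionals). [folklore] -/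
theorem convex_certSet (σ : Equiv.Perm (Fin n)) (u : EuclideanSpace ℝ (Fin (d + 1))) :
    Convex ℝ (certSet n σ u) := by
  intro x hx y hy a b ha hb hab k l hkl
  simp only [Pi.add_apply, Pi.smul_apply, inner_add_right, inner_smul_right]
  have hx' := hx hkl
  have hy' := hy hkl
  simp only at hx' hy'
  rcases ha.eq_or_lt with rfl | ha'
  · rw [zero_add] at hab; subst hab; simpa using hy'
  · nlinarith

/-- **Linear certificate for the extended tube** (space dimension `≥ 1`). If the heights
`⟪u, x_{σ(k)}⟫`, `u ≠ 0`, strictly increase along `σ`, then the permuted Euclidean point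
`(euclideanPoint x) ∘ σ` lies in the extended relative tube: the rotation `M ∈ SO(d + 1)` with first
row `u/‖u‖` (`exists_specialOrthogonal_row_zero`) rotates `x ∘ σ` to a configuration with strictly
increasing times, whose Euclidean point lies in `𝒯ʳₙ` (`euclideanPoint_mem_relForwardTube`), and
`Λ_M ∈ L₊(ℂ)` (`wickEquiv`) relates the two Euclidean points (OS I §5 p. 97; Glimm–Jaffe
Cor. 19.5.6). [cite: OsterwalderSchraderCMP1973, §5 p. 97] -/
theorem euclideanPoint_perm_mem_relExtendedTube_of_strictMono {m : ℕ}
    {x : Fin n → EuclideanSpace ℝ (Fin (m + 2))} {σ : Equiv.Perm (Fin n)}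
    {u : EuclideanSpace ℝ (Fin (m + 2))} (hu : u ≠ 0)
    (h : StrictMono fun k => ⟪u, x (σ k)⟫) :
    (fun k => euclideanPoint x (σ k)) ∈ relExtendedTube (m + 1) n := by
  -- normalise `u` and complete it to a rotation
  set u₁ : EuclideanSpace ℝ (Fin (m + 2)) := ‖u‖⁻¹ • u with hu₁
  have hnorm : 0 < ‖u‖ := norm_pos_iff.2 hu
  have hu₁n : ‖u₁‖ = 1 := by
    rw [hu₁, norm_smul, norm_inv, norm_norm, inv_mul_cancel₀ hnorm.ne']
  obtain ⟨M, hM, hdet, hrow⟩ := exists_specialOrthogonal_row_zero u₁ hu₁n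
  have hMT : Mᵀᵀ * Mᵀ = 1 := by rw [Matrix.transpose_transpose]; exact mul_eq_one_comm.1 hM
  -- the rotated, reordered configuration has strictly increasing times
  set y : Fin n → EuclideanSpace ℝ (Fin (m + 2)) := rotateConfig M (x ∘ σ) with hy
  have hy0 : ∀ k, y k 0 = ‖u‖⁻¹ * ⟪u, x (σ k)⟫ := by
    intro k
    have h1 : y k 0 = ∑ j, M 0 j * x (σ k) j := by
      rw [hy, rotateConfig_apply]
      simp [Matrix.mulVec, dotProduct]
    have h2 : ⟪u, x (σ k)⟫ = ∑ j, u j * x (σ k) j := by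
      rw [EuclideanSpace.inner_eq_star_dotProduct, star_trivial, dotProduct_comm]; rfl
    rw [h1, h2, Finset.mul_sum]
    refine Finset.sum_congr rfl fun j _ => ?_
    rw [hrow j, hu₁, PiLp.smul_apply, smul_eq_mul]
    ring
  have hmono : StrictMono fun k => y k 0 := by
    intro k l hkl
    simp only [hy0]
    exact mul_lt_mul_of_pos_left (h hkl) (inv_pos.2 hnorm)
  have hymem := euclideanPoint_mem_relForwardTube hmono
  -- `euclideanPoint (x ∘ σ) = Λ_{Mᵀ} (euclideanPoint y)`
  refine ⟨wickEquiv Mᵀ hMT, wickEquiv_mem_properComplexLorentzGroup Mᵀ hMT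
      (by rw [Matrix.det_transpose, hdet]), euclideanPoint y, hymem, ?_⟩
  funext k
  rw [wickEquiv_apply, hy, ← wickMatrix_mulVec_euclideanPoint, Matrix.mulVec_mulVec,
    ← wickMatrix_mul, hM, wickMatrix_one, Matrix.one_mulVec]
  rfl

/-- Membership in a certificate set implies membership of the permuted Euclidean point in the
extended relative tube (space dimension `≥ 1`). [cite: OsterwalderSchraderCMP1973, §5 p. 97] -/
theorem euclideanPoint_perm_mem_relExtendedTube_of_mem_certSet {m : ℕ}
    {x : Fin n → EuclideanSpace ℝ (Fin (m + 2))} {σ : Equiv.Perm (Fin n)}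
    {u : EuclideanSpace ℝ (Fin (m + 2))} (hu : u ≠ 0) (h : x ∈ certSet n σ u) :
    (fun k => euclideanPoint x (σ k)) ∈ relExtendedTube (m + 1) n :=
  euclideanPoint_perm_mem_relExtendedTube_of_strictMono hu h

/-- **Every injective Euclidean configuration, lexicographically sorted, gives a point of the
extended relative tube** (space dimension `≥ 1`; OS I §5 p. 97 / Glimm–Jaffe Cor. 19.5.6 in the
explicit form "sort, then rotate slightly"). [cite: OsterwalderSchraderCMP1973, §5 p. 97] -/
theorem euclideanPoint_eSort_mem_relExtendedTube {m : ℕ}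
    {x : Fin n → EuclideanSpace ℝ (Fin (m + 2))} (hx : Function.Injective x) :
    (fun k => euclideanPoint x (eSort x k)) ∈ relExtendedTube (m + 1) n := by
  obtain ⟨ε, hε⟩ := (eventually_strictMono_inner_uPow_eSort hx).exists
  exact euclideanPoint_perm_mem_relExtendedTube_of_strictMono (uPow_ne_zero ε) hε

end Literature.MathematicalPhysics.QuantumLattice
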